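import Summits.ValiantsHypothesis.ValiantsHypothesis.Theorems.PolyaContinuedSignedCoverLittleTransfer
import Literature.Combinatorics.SimpleGraph.PfaffianIsomorphism
import HarnessLib

/-!
# Route PolyaContinued — support item `SignedCoverLittle` (stmt-ValiantsHypothesis-7426):
# the H-side normal form (step (N) of `proof-LabelTransfer.md`)

Sequel to `PolyaContinuedSignedCoverLittleTransfer.lean`. Step (N) of the paper proof normalises a
label identity `Σ_{σ ∈ PM(H)} Π_i X (φ (i, σ i)) = PM_E` so that a chosen perfect matching of `H`,
its image in `E`, and the relabelling `φ` on the diagonal are all the identity. Here this is done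
ENTIRELY ON THE `H`-SIDE, leaving `E` and its presentation untouched: if the diagonal (identity
matching) lies inside `E`, then after

1. relabelling the columns of `H` by the preimage `σ₀` of the diagonal (so that `σ₀` becomes the
   diagonal of the new `H`), and
2. relabelling rows AND columns of `H` simultaneously by the row bijection `b` of
   `exists_rowPerm_of_labelExponent_eq` (`φ (i, σ₀ i) = (b i, b i)`),

we obtain `H' = relabel H b (b σ₀⁻¹)` and `φ' (x, y) = φ (b⁻¹ x, σ₀ (b⁻¹ y))` with: `H'` isomorphic
to `H` (hence Pfaffian iff `H` is, `IsIsomorphic.isPfaffianBipartite_iff`), the diagonal inside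
`H'`, `φ' (x, x) = (x, x)`, and the SAME label identity for `(H', E, φ')` (reindex the sum over
perfect matchings by `σ ↦ σ₀ b⁻¹ σ b`).

* `labelSum_eq_of_equiv` — reindexing a label sum along a bijection of permutations;
* `card_filter_isPerfectMatching_relabel` — cell multiplicities (the number of perfect matchings
  through a cell) are invariant under relabelling rows and columns;
* `labelIdentity_relabel_target` — moving the TARGET by a column permutation `π₀⁻¹` (so that a
  chosen perfect matching `π₀` of `E` becomes the diagonal) keeps the label identity, with `φ`
  composed accordingly (`rename`);
* `exists_normalForm` — the normal form when the diagonal already lies inside `E` (so `E` stays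
  fixed), together with the transfer of cell multiplicities from `H` to `H'`;
  `exists_normalForm_of_isPerfectMatching` — the same from any perfect matching `π₀` of `E`, the
  new target being `relabel E 1 π₀⁻¹`. Consumed by the closer of the item: restrict
  (`labelIdentity_restrict`) → normalise (this file) → dicircuit structure
  (`…TransferCircuits.lean`) → ear lemma → even multiplicities → parity.

All statements over `ℂ` and `Fin n`; no new definitions.
-/

noncomputable section

namespace Summit.ValiantsHypothesis.PolyaContinued

open MvPolynomial Finset Literature.Combinatorics.SimpleGraph Equiv

variable {n : ℕ}

/-- **Reindexing a label sum.** If a bijection `e` of the permutations carries the perfect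
matchings of `H'` exactly onto those of `H` and the `φ'`-labels of `σ` onto the `φ`-labels of
`e σ` (as products of variables), the two label polynomials agree. [folklore] -/
theorem labelSum_eq_of_equiv {H H' : Finset (Fin n × Fin n)}
    {φ φ' : Fin n × Fin n → Fin n × Fin n} (e : Perm (Fin n) ≃ Perm (Fin n))
    (hmem : ∀ σ : Perm (Fin n), (∀ i, (i, σ i) ∈ H') ↔ ∀ i, (i, (e σ) i) ∈ H)
    (hprod : ∀ σ : Perm (Fin n), ∏ i, (X (φ' (i, σ i)) : MvPolynomial (Fin n × Fin n) ℂ) =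
      ∏ i, (X (φ (i, (e σ) i)) : MvPolynomial (Fin n × Fin n) ℂ)) :
    (∑ σ : Equiv.Perm (Fin n), if (∀ i, (i, σ i) ∈ H') then
        ∏ i, (X (φ' (i, σ i)) : MvPolynomial (Fin n × Fin n) ℂ) else 0) =
      ∑ σ : Equiv.Perm (Fin n), if (∀ i, (i, σ i) ∈ H) then
        ∏ i, (X (φ (i, σ i)) : MvPolynomial (Fin n × Fin n) ℂ) else 0 := by
  refine Fintype.sum_equiv e _ _ fun σ => ?_
  by_cases hσ : ∀ i, (i, σ i) ∈ H'
  · rw [if_pos hσ, if_pos ((hmem σ).1 hσ), hprod σ]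
  · rw [if_neg hσ, if_neg fun h => hσ ((hmem σ).2 h)]

/-- Membership in the doubly relabelled graph `relabel H b (b σ₀⁻¹)`:
`(x, y) ∈ H' ↔ (b⁻¹ x, σ₀ (b⁻¹ y)) ∈ H`. [folklore] -/
theorem mem_relabel_mul_symm_iff (H : Finset (Fin n × Fin n)) (b σ₀ : Perm (Fin n))
    (x y : Fin n) :
    (x, y) ∈ relabel H b (b * σ₀.symm) ↔ (b.symm x, σ₀ (b.symm y)) ∈ H := by
  rw [mem_relabel_iff]
  simp only [Perm.mul_def, Equiv.symm_trans_apply, Equiv.symm_symm]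

/-- **Cell multiplicities are invariant under relabelling**: the number of perfect matchings of
`relabel H ρ κ` through the cell `(ρ i, κ j)` is the number of perfect matchings of `H` through
`(i, j)` (`σ ↦ κ σ ρ⁻¹`). [folklore] -/
theorem card_filter_isPerfectMatching_relabel (H : Finset (Fin n × Fin n)) (ρ κ : Perm (Fin n))
    (i j : Fin n) :
    (Finset.univ.filter fun σ : Perm (Fin n) =>
        (∀ x, (x, σ x) ∈ relabel H ρ κ) ∧ σ (ρ i) = κ j).card =
      (Finset.univ.filter fun σ : Perm (Fin n) => (∀ x, (x, σ x) ∈ H) ∧ σ i = j).card := by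
  classical
  -- `σ' ↦ κ⁻¹ σ' ρ` carries the left set onto the right one
  refine Finset.card_bij (fun σ _ => (ρ.trans σ).trans κ.symm) (fun σ hσ => ?_)
    (fun σ₁ _ σ₂ _ h => ?_) (fun σ hσ => ?_)
  · rw [Finset.mem_filter] at hσ ⊢
    refine ⟨Finset.mem_univ _, fun x => ?_, ?_⟩
    · have h := hσ.2.1 (ρ x)
      rw [mem_relabel_iff] at h
      simpa using h
    · simp [hσ.2.2]
  · refine Equiv.ext fun x => ?_
    have := congrArg (fun τ : Perm (Fin n) => κ (τ (ρ.symm x))) h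
    simpa using this
  · rw [Finset.mem_filter] at hσ
    refine ⟨(ρ.symm.trans σ).trans κ, Finset.mem_filter.2 ⟨Finset.mem_univ _, fun x => ?_, ?_⟩, ?_⟩
    · rw [mem_relabel_iff]
      simpa using hσ.2.1 (ρ.symm x)
    · simp [hσ.2.2]
    · ext x; simp

/-- The diagonal lies inside `relabel E 1 π₀⁻¹` when `π₀` is a perfect matching of `E`. [folklore] -/
theorem diag_mem_relabel_symm {E : Finset (Fin n × Fin n)} {π₀ : Perm (Fin n)}
    (hπ₀ : ∀ i, (i, π₀ i) ∈ E) (i : Fin n) : (i, i) ∈ relabel E (Equiv.refl _) π₀.symm := by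
  rw [mem_relabel_iff]
  simpa using hπ₀ i

/-- **Moving the target by a column permutation keeps the label identity.** If
`Σ_{σ ⊆ H} Π X (φ (i, σ i)) = PM_E` and `π₀` is any permutation, then the same holds for the
target `relabel E 1 π₀⁻¹` (columns renamed by `π₀⁻¹`, so that `π₀` becomes the diagonal) and the
relabelling `c ↦ ((φ c).1, π₀⁻¹ (φ c).2)` (apply `rename` to both sides). [folklore] -/
theorem labelIdentity_relabel_target {H E : Finset (Fin n × Fin n)}
    {φ : Fin n × Fin n → Fin n × Fin n}
    (hid : (∑ σ : Equiv.Perm (Fin n), if (∀ i, (i, σ i) ∈ H) then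
        ∏ i, (X (φ (i, σ i)) : MvPolynomial (Fin n × Fin n) ℂ) else 0) =
      perfectMatchingPoly E ℂ)
    (π₀ : Perm (Fin n)) :
    (∑ σ : Equiv.Perm (Fin n), if (∀ i, (i, σ i) ∈ H) then
        ∏ i, (X (((φ (i, σ i)).1, π₀.symm (φ (i, σ i)).2)) : MvPolynomial (Fin n × Fin n) ℂ)
        else 0) =
      perfectMatchingPoly (relabel E (Equiv.refl _) π₀.symm) ℂ := by
  classical
  let ψ : Fin n × Fin n → Fin n × Fin n := fun c => (c.1, π₀.symm c.2)
  have h := congrArg (rename ψ) hid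
  rw [map_sum] at h
  -- left side
  have hL : ∀ σ : Perm (Fin n), rename ψ (if (∀ i, (i, σ i) ∈ H) then
      ∏ i, (X (φ (i, σ i)) : MvPolynomial (Fin n × Fin n) ℂ) else 0) =
      if (∀ i, (i, σ i) ∈ H) then
        ∏ i, (X (((φ (i, σ i)).1, π₀.symm (φ (i, σ i)).2)) : MvPolynomial (Fin n × Fin n) ℂ)
        else 0 := by
    intro σ
    split_ifs
    · rw [map_prod]
      exact Finset.prod_congr rfl fun i _ => rename_X ψ _
    · exact map_zero _
  simp_rw [hL] at h
  rw [h, perfectMatchingPoly_eq_sum_ite, perfectMatchingPoly_eq_sum_ite, map_sum]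
  -- right side: reindex `π ↦ π₀⁻¹ π`
  symm
  refine Fintype.sum_equiv (Equiv.mulLeft π₀) _ _ fun π => ?_
  have hmem : (∀ i, (i, π i) ∈ relabel E (Equiv.refl _) π₀.symm) ↔ ∀ i, (i, (π₀ * π) i) ∈ E := by
    refine forall_congr' fun i => ?_
    rw [mem_relabel_iff]
    simp [Perm.mul_apply]
  simp only [Equiv.coe_mulLeft]
  by_cases hπ : ∀ i, (i, π i) ∈ relabel E (Equiv.refl _) π₀.symm
  · rw [if_pos hπ, if_pos (hmem.1 hπ), map_prod]
    refine Finset.prod_congr rfl fun i _ => ?_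
    rw [rename_X]
    simp [ψ, Perm.mul_apply]
  · rw [if_neg hπ, if_neg fun h' => hπ (hmem.2 h'), map_zero]

/-- **The H-side normal form.** Under the label identity for `(H, E, φ)`, if the diagonal lies
inside `E` there are `H' ⊆ Fin n × Fin n` and `φ'` with: `H` Pfaffian iff `H'` Pfaffian, the
diagonal inside `H'`, `φ' (x, x) = (x, x)` for all `x`, the label identity for `(H', E, φ')`, and
every cell multiplicity of `H` (number of perfect matchings through a cell) is a cell multiplicity
of `H'`. (`H' = relabel H b (b σ₀⁻¹)`, `φ' (x, y) = φ (b⁻¹ x, σ₀ (b⁻¹ y))`, where `σ₀` is the preimage of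
the diagonal and `b` its row bijection; step (N) of the paper proof, moved to the `H`-side.)
[folklore] -/
theorem exists_normalForm {H E : Finset (Fin n × Fin n)} {φ : Fin n × Fin n → Fin n × Fin n}
    (hid : (∑ σ : Equiv.Perm (Fin n), if (∀ i, (i, σ i) ∈ H) then
        ∏ i, (X (φ (i, σ i)) : MvPolynomial (Fin n × Fin n) ℂ) else 0) =
      perfectMatchingPoly E ℂ)
    (hEd : ∀ i, (i, i) ∈ E) :
    ∃ (H' : Finset (Fin n × Fin n)) (φ' : Fin n × Fin n → Fin n × Fin n),
      (IsPfaffianBipartite H ↔ IsPfaffianBipartite H') ∧ (∀ x, (x, x) ∈ H') ∧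
      (∀ x, φ' (x, x) = (x, x)) ∧
      (∑ σ : Equiv.Perm (Fin n), if (∀ i, (i, σ i) ∈ H') then
          ∏ i, (X (φ' (i, σ i)) : MvPolynomial (Fin n × Fin n) ℂ) else 0) =
        perfectMatchingPoly E ℂ ∧
      (∀ i j : Fin n, ∃ x y : Fin n,
        (Finset.univ.filter fun σ : Perm (Fin n) => (∀ k, (k, σ k) ∈ H) ∧ σ i = j).card =
          (Finset.univ.filter fun σ : Perm (Fin n) => (∀ k, (k, σ k) ∈ H') ∧ σ x = y).card) := by
  classical
  -- the preimage `σ₀` of the diagonal and its row bijection `b`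
  have h1E : ∀ i, (i, (1 : Perm (Fin n)) i) ∈ E := fun i => by simpa using hEd i
  obtain ⟨σ₀, hσ₀, hσ₀1⟩ := exists_preimage_of_labelIdentity hid h1E
  obtain ⟨b, hb⟩ := exists_rowPerm_of_labelExponent_eq hσ₀1
  simp only [Perm.coe_one, id_eq] at hb
  -- the normal form
  set H' : Finset (Fin n × Fin n) := relabel H b (b * σ₀.symm) with hH'
  set φ' : Fin n × Fin n → Fin n × Fin n := fun c => φ (b.symm c.1, σ₀ (b.symm c.2)) with hφ'
  have hP : IsPfaffianBipartite H ↔ IsPfaffianBipartite H' :=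
    (isIsomorphic_relabel H b (b * σ₀.symm)).isPfaffianBipartite_iff
  have hD : ∀ x, (x, x) ∈ H' := fun x => by
    rw [hH', mem_relabel_mul_symm_iff]
    exact hσ₀ _
  have hdiagφ : ∀ x, φ' (x, x) = (x, x) := fun x => by
    show φ (b.symm x, σ₀ (b.symm x)) = (x, x)
    rw [hb, Equiv.apply_symm_apply]
  have hid' : (∑ σ : Equiv.Perm (Fin n), if (∀ i, (i, σ i) ∈ H') then
      ∏ i, (X (φ' (i, σ i)) : MvPolynomial (Fin n × Fin n) ℂ) else 0) =
      perfectMatchingPoly E ℂ := by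
    rw [← hid]
    -- reindex by `σ ↦ σ₀ b⁻¹ σ b`
    refine labelSum_eq_of_equiv
      ((Equiv.mulRight b).trans (Equiv.mulLeft (σ₀ * b⁻¹))) (fun σ => ?_) (fun σ => ?_)
    · have key : ∀ x, ((x, σ x) ∈ H' ↔
          (b.symm x, ((σ₀ * b⁻¹) * (σ * b)) (b.symm x)) ∈ H) := fun x => by
        rw [hH', mem_relabel_mul_symm_iff]
        simp only [Perm.mul_apply, Perm.inv_def, Equiv.apply_symm_apply]
      simp only [Equiv.trans_apply, Equiv.coe_mulRight, Equiv.coe_mulLeft]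
      constructor
      · intro h i
        have := (key (b i)).1 (h (b i))
        rwa [Equiv.symm_apply_apply] at this
      · intro h x
        exact (key x).2 (h (b.symm x))
    · simp only [Equiv.trans_apply, Equiv.coe_mulRight, Equiv.coe_mulLeft]
      refine Fintype.prod_equiv b.symm _ _ fun x => ?_
      simp only [hφ', Perm.mul_apply, Perm.inv_def, Equiv.apply_symm_apply]
  have hmult : ∀ i j : Fin n, ∃ x y : Fin n,
      (Finset.univ.filter fun σ : Perm (Fin n) => (∀ k, (k, σ k) ∈ H) ∧ σ i = j).card =
        (Finset.univ.filter fun σ : Perm (Fin n) => (∀ k, (k, σ k) ∈ H') ∧ σ x = y).card :=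
    fun i j => ⟨b i, (b * σ₀.symm) j,
      (card_filter_isPerfectMatching_relabel H b (b * σ₀.symm) i j).symm⟩
  exact ⟨H', φ', hP, hD, hdiagφ, hid', hmult⟩

/-- **The H-side normal form from any reference matching.** Under the label identity for
`(H, E, φ)` and a perfect matching `π₀` of `E`: there are `H', φ'` with `H` Pfaffian iff `H'`
Pfaffian, the diagonal inside `H'`, `φ' (x, x) = (x, x)`, the label identity for
`(H', relabel E 1 π₀⁻¹, φ')` — the target moved by the column permutation making `π₀` the
diagonal (`diag_mem_relabel_symm`) — and the cell multiplicities of `H` among those of `H'`.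
[folklore] -/
theorem exists_normalForm_of_isPerfectMatching {H E : Finset (Fin n × Fin n)}
    {φ : Fin n × Fin n → Fin n × Fin n}
    (hid : (∑ σ : Equiv.Perm (Fin n), if (∀ i, (i, σ i) ∈ H) then
        ∏ i, (X (φ (i, σ i)) : MvPolynomial (Fin n × Fin n) ℂ) else 0) =
      perfectMatchingPoly E ℂ)
    {π₀ : Perm (Fin n)} (hπ₀ : ∀ i, (i, π₀ i) ∈ E) :
    ∃ (H' : Finset (Fin n × Fin n)) (φ' : Fin n × Fin n → Fin n × Fin n),
      (IsPfaffianBipartite H ↔ IsPfaffianBipartite H') ∧ (∀ x, (x, x) ∈ H') ∧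
      (∀ x, φ' (x, x) = (x, x)) ∧
      (∑ σ : Equiv.Perm (Fin n), if (∀ i, (i, σ i) ∈ H') then
          ∏ i, (X (φ' (i, σ i)) : MvPolynomial (Fin n × Fin n) ℂ) else 0) =
        perfectMatchingPoly (relabel E (Equiv.refl _) π₀.symm) ℂ ∧
      (∀ i j : Fin n, ∃ x y : Fin n,
        (Finset.univ.filter fun σ : Perm (Fin n) => (∀ k, (k, σ k) ∈ H) ∧ σ i = j).card =
          (Finset.univ.filter fun σ : Perm (Fin n) => (∀ k, (k, σ k) ∈ H') ∧ σ x = y).card) :=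
  exists_normalForm (φ := fun c => ((φ c).1, π₀.symm (φ c).2))
    (labelIdentity_relabel_target hid π₀) (diag_mem_relabel_symm hπ₀)

end Summit.ValiantsHypothesis.PolyaContinued
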